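import Mathlib
import Summits.AtomisticToContinuum.HydrodynamicLimit.Theorems.ImplosionDichotomyDenseExcursionPackingResolventExistence

/-!
# Existence half of the packing-order resolvent with the `(1 + S)`-weighted source hypothesis
# (crux `DenseExcursion`, stmt-AtomisticToContinuum-12586, line `sonic-cavity-renewal` v7 → v8, stub `stub_packingResolvent`)

Helper file (`--supports stmt-AtomisticToContinuum-12586`) for the registered stub `stub_packingResolvent`; it proves the registered
helper `packingResolvent_existenceW`: the existence statement of `packingResolvent_existence` (p156607) under the WEAKER source
hypothesis `∀ y, |f₁ y|/(1 + S y) + |f₂ y|/S y ≤ N` — the norm of the corrected vocabulary `PackingResolventW` proposed by the wave-3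
worker C (`work/stubs/C_packingResolvent.REPORT.md` §3: clause (ii) of `PackingResolvent` is false at the pinned profile because of
the acoustic layer at the centre; with the weight `1/(1 + S)` on the `w`-slot the Laplace gain is true).

**Mathematics.** A regular real source with the weighted bound is globally bounded in the unweighted norm `|f₁| + |f₂|/S`
(`source_unweighted_of_weighted`): `|f₂|/S ≤ N` everywhere; `|f₁| ≤ K` on `x ≤ 1` by regularity (`weightedSup_of_isRegularPair`);
`|f₁| ≤ N(1 + S) ≤ N(1 + B)` on `[1, Y]` (`S` continuous) and `≤ 2N` beyond `Y` (`S → 0`). Then `packingResolvent_existence` applies.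
-/

noncomputable section

open Filter Set Topology

namespace Summit.AtomisticToContinuum.HydrodynamicLimit.Theorems.PackingAnalyticImplosion

open Summit.AtomisticToContinuum.HydrodynamicLimit.Theorems.R2OneModeTwoConditions
open Summit.AtomisticToContinuum.HydrodynamicLimit.Theorems.SonicCavityRenewal

/-- **A `(1 + S)`-WEIGHTED SOURCE BOUND IS A GLOBAL UNWEIGHTED ONE** for a regular real pair over a monatomic profile:
`|f₂|/S ≤ N`; `|f₁| ≤ K` on `x ≤ 1` (regularity), `≤ N(1 + B)` on `[1, Y]`, `≤ 2N` for `x ≥ Y` where `S < 1`. [folklore] -/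
theorem source_unweighted_of_weighted {r : ℝ} {W S f₁ f₂ : ℝ → ℝ} (hP : IsMonatomicProfile r W S)
    (hf : IsRegularPair (fun x => (f₁ x : ℂ)) (fun x => (f₂ x : ℂ))) {N : ℝ}
    (hN : ∀ y, |f₁ y| / (1 + S y) + |f₂ y| / S y ≤ N) : ∃ N'' : ℝ, ∀ y, |f₁ y| + |f₂ y| / S y ≤ N'' := by
  obtain ⟨-, -, -, hSs, hSpos, -, -, -, tS⟩ := hP
  -- `S` is bounded on `[1, ∞)`
  have ev : ∀ᶠ y in atTop, S y < 1 := tS.eventually (gt_mem_nhds (by norm_num))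
  obtain ⟨Y, hY⟩ := (ev.and (eventually_ge_atTop 1)).exists_forall_of_atTop
  obtain ⟨B, hB⟩ := (isCompact_Icc : IsCompact (Icc 1 Y)).exists_bound_of_continuousOn hSs.continuous.continuousOn
  -- `|f₁| ≤ K` on `y ≤ 1`
  obtain ⟨K, hK⟩ := weightedSup_of_isRegularPair hf
  have hN0 : ∀ y, |f₂ y| / S y ≤ N := fun y => by
    have h := hN y
    have : 0 ≤ |f₁ y| / (1 + S y) := div_nonneg (abs_nonneg _) (by linarith [hSpos y])
    linarith
  have hf₁ : ∀ y, |f₁ y| ≤ N * (1 + S y) := fun y => by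
    have h := hN y
    have h1 : 0 < 1 + S y := by linarith [hSpos y]
    have h2 : |f₁ y| / (1 + S y) ≤ N := by linarith [div_nonneg (abs_nonneg (f₂ y)) (hSpos y).le]
    rwa [div_le_iff₀ h1] at h2
  have hNn : 0 ≤ N := le_trans (div_nonneg (abs_nonneg _) (hSpos 0).le) (hN0 0)
  refine ⟨max K (max (N * (1 + B)) (N * 2)) + N, fun y => ?_⟩
  have h2 := hN0 y
  suffices h1 : |f₁ y| ≤ max K (max (N * (1 + B)) (N * 2)) by linarith
  rcases le_or_gt y 1 with hy | hy
  · have h := hK y hy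
    rw [Complex.norm_real, Complex.norm_real, Real.norm_eq_abs, Real.norm_eq_abs] at h
    exact le_trans (by nlinarith [abs_nonneg (f₂ y), Real.exp_pos y]) (le_max_left _ _)
  · rcases le_or_gt y Y with hyY | hyY
    · have hSB : S y ≤ B := by
        have h := hB y ⟨hy.le, hyY⟩
        rw [Real.norm_eq_abs] at h
        exact (le_abs_self _).trans h
      calc |f₁ y| ≤ N * (1 + S y) := hf₁ y
        _ ≤ N * (1 + B) := by gcongr
        _ ≤ _ := le_trans (le_max_left _ _) (le_max_right _ _)
    · have hS1 : S y < 1 := (hY y hyY.le).1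
      calc |f₁ y| ≤ N * (1 + S y) := hf₁ y
        _ ≤ N * 2 := by nlinarith
        _ ≤ _ := le_trans (le_max_right _ _) (le_max_right _ _)

/-- **Helper `packingResolvent_existenceW` of `stub_packingResolvent`: EXISTENCE AT EVERY ORDER UNDER THE WEIGHTED SOURCE
HYPOTHESIS** — `packingResolvent_existence` (p156607) composed with `source_unweighted_of_weighted`. [folklore] -/
theorem packingResolvent_existenceW : ∀ (r : ℝ) (W S : ℝ → ℝ), (17307 / 15625 : ℝ) ≤ r → r ≤ 697 / 625 → IsMonatomicProfile r W S → CavityTube r W S → CavityResolventCk 5 r W S → PinnedRate r W S → ∀ k : ℕ, 1 ≤ k → ∀ f₁ f₂ : ℝ → ℝ, IsRegularPair (fun x => (f₁ x : ℂ)) (fun x => (f₂ x : ℂ)) → (∃ N : ℝ, ∀ y, |f₁ y| / (1 + S y) + |f₂ y| / S y ≤ N) → ∃ u₁ u₂ : ℝ → ℝ, IsRegularPair (fun x => (u₁ x : ℂ)) (fun x => (u₂ x : ℂ)) ∧ (∀ x, (((k : ℝ) * (3 * (r - 1)) : ℝ) : ℂ) * (u₁ x : ℂ) - linW r W S (fun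 y => (u₁ y : ℂ)) (fun y => (u₂ y : ℂ)) x = (f₁ x : ℂ) ∧ (((k : ℝ) * (3 * (r - 1)) : ℝ) : ℂ) * (u₂ x : ℂ) - linS r W S (fun y => (u₁ y : ℂ)) (fun y => (u₂ y : ℂ)) x = (f₂ x : ℂ)) ∧ ∃ N' : ℝ, ∀ y, |u₁ y| + |u₂ y| / S y ≤ N' := by
  intro r W S hlo hhi hP hT hres hRate k hk f₁ f₂ hf hfN
  obtain ⟨N, hN⟩ := hfN
  exact packingResolvent_existence r W S hlo hhi hP hT hres hRate k hk f₁ f₂ hf (source_unweighted_of_weighted hP hf hN)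

end Summit.AtomisticToContinuum.HydrodynamicLimit.Theorems.PackingAnalyticImplosion

end
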